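import Summits.RiemannHypothesis.RiemannHypothesis.Theorems.WeilFormatCTrigTailSums
import Summits.RiemannHypothesis.RiemannHypothesis.Theorems.WeilFormatCLogTailSums
import HarnessLib

/-!
# Format C, design C∞: Abel radii for the log-weighted oscillatory tail sums

Route context: Fourier–Galerkin / Schur-complement certificates of Weil positivity on a window ("format C", design C∞;
cell memo `run/shared/lean/pub/rh-explicit/rh-explicit-weil-2/gen9/CINF-DOOR-SIZING.md` §3/§6; supporting
stmt-RiemannHypothesis-0098; seat rh-explicit-weil-2, (E) side of the C∞ door of rh-explicit-weil-10).

Off-diagonal entries of the MS-Gram of the C∞ coupling tail between a log-family member `m^{−(k+1)} log m` (or `log² m`) and an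
oscillatory member `cos(mφ)`, `sin(mφ)` are bounded by Abel summation (`abs_sum_Ico_mul_cos_le` / `…_sin_le` of
`WeilFormatCTrigTailSums`) once the weight is nonnegative and antitone (`log_div_pow_antitoneOn`, `logSq_div_pow_antitoneOn`):

* `abs_sum_Ico_log_div_pow_mul_cos_le`, `…_sin_le` — `|Σ_{m∈Ico M N} (log m/m^{k+1}) cos(mφ)| ≤ (log M/M^{k+1})/|sin(φ/2)|`
  for `1 ≤ k`, `2 ≤ M` (and `sin`);
* `abs_sum_Ico_logSq_div_pow_mul_cos_le`, `…_sin_le` — the same with `log² m`, `3 ≤ M`.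

Elementary; standard axioms; no definitions; no RH claim.
-/

-- `Summit.RiemannHypothesis.RiemannHypothesis.…` is the layout-mandated namespace (summit = problem name).
set_option linter.dupNamespace false

noncomputable section

open Real Finset

namespace Summit.RiemannHypothesis.RiemannHypothesis.Theorems.WeilFormatC

/-- Nonnegativity and monotonicity data of `m ↦ log m/m^{k+1}` from `M ≥ 2` on (`k ≥ 1`). -/
theorem log_div_pow_weight {k : ℕ} (hk : 1 ≤ k) {M : ℕ} (hM : 2 ≤ M) :
    (∀ m : ℕ, M ≤ m → 0 ≤ Real.log m / (m : ℝ) ^ (k + 1)) ∧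
      ∀ m : ℕ, M ≤ m → Real.log ((m + 1 : ℕ) : ℝ) / (((m + 1 : ℕ) : ℝ)) ^ (k + 1) ≤ Real.log m / (m : ℝ) ^ (k + 1) := by
  refine ⟨fun m hm ↦ ?_, fun m hm ↦ ?_⟩
  · have : (1 : ℝ) ≤ m := by exact_mod_cast le_trans (by omega : 1 ≤ M) hm
    exact div_nonneg (Real.log_nonneg this) (by positivity)
  · have h2 : (2 : ℝ) ≤ m := by exact_mod_cast le_trans hM hm
    have h := log_div_pow_antitoneOn hk (show (m : ℝ) ∈ Set.Ici (2 : ℝ) from h2)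
      (show ((m : ℝ) + 1) ∈ Set.Ici (2 : ℝ) by simp only [Set.mem_Ici]; linarith) (by linarith)
    simpa [Nat.cast_add, Nat.cast_one] using h

/-- Nonnegativity and monotonicity data of `m ↦ log² m/m^{k+1}` from `M ≥ 3` on (`k ≥ 1`). -/
theorem logSq_div_pow_weight {k : ℕ} (hk : 1 ≤ k) {M : ℕ} (hM : 3 ≤ M) :
    (∀ m : ℕ, M ≤ m → 0 ≤ Real.log m ^ 2 / (m : ℝ) ^ (k + 1)) ∧
      ∀ m : ℕ, M ≤ m →
        Real.log ((m + 1 : ℕ) : ℝ) ^ 2 / (((m + 1 : ℕ) : ℝ)) ^ (k + 1) ≤ Real.log m ^ 2 / (m : ℝ) ^ (k + 1) := by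
  refine ⟨fun m _ ↦ by positivity, fun m hm ↦ ?_⟩
  have h3 : (3 : ℝ) ≤ m := by exact_mod_cast le_trans hM hm
  have h := logSq_div_pow_antitoneOn hk (show (m : ℝ) ∈ Set.Ici (3 : ℝ) from h3)
    (show ((m : ℝ) + 1) ∈ Set.Ici (3 : ℝ) by simp only [Set.mem_Ici]; linarith) (by linarith)
  simpa [Nat.cast_add, Nat.cast_one] using h

/-- **Abel radius, log weight, cosine**: `|Σ_{m∈Ico M N} (log m/m^{k+1}) cos(mφ)| ≤ (log M/M^{k+1})/|sin(φ/2)|`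
(`sin(φ/2) ≠ 0`, `1 ≤ k`, `2 ≤ M`, every `N`). -/
theorem abs_sum_Ico_log_div_pow_mul_cos_le {φ : ℝ} (hφ : Real.sin (φ / 2) ≠ 0) {k : ℕ} (hk : 1 ≤ k) {M : ℕ}
    (hM : 2 ≤ M) (N : ℕ) :
    |∑ m ∈ Finset.Ico M N, Real.log m / (m : ℝ) ^ (k + 1) * Real.cos (m * φ)|
      ≤ (Real.log M / (M : ℝ) ^ (k + 1)) / |Real.sin (φ / 2)| := by
  obtain ⟨h0, hmono⟩ := log_div_pow_weight hk hM
  exact abs_sum_Ico_mul_cos_le hφ (g := fun m : ℕ ↦ Real.log m / (m : ℝ) ^ (k + 1)) h0 hmono N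

/-- **Abel radius, log weight, sine**: `|Σ_{m∈Ico M N} (log m/m^{k+1}) sin(mφ)| ≤ (log M/M^{k+1})/|sin(φ/2)|`. -/
theorem abs_sum_Ico_log_div_pow_mul_sin_le {φ : ℝ} (hφ : Real.sin (φ / 2) ≠ 0) {k : ℕ} (hk : 1 ≤ k) {M : ℕ}
    (hM : 2 ≤ M) (N : ℕ) :
    |∑ m ∈ Finset.Ico M N, Real.log m / (m : ℝ) ^ (k + 1) * Real.sin (m * φ)|
      ≤ (Real.log M / (M : ℝ) ^ (k + 1)) / |Real.sin (φ / 2)| := by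
  obtain ⟨h0, hmono⟩ := log_div_pow_weight hk hM
  exact abs_sum_Ico_mul_sin_le hφ (g := fun m : ℕ ↦ Real.log m / (m : ℝ) ^ (k + 1)) h0 hmono N

/-- **Abel radius, log² weight, cosine**: `|Σ_{m∈Ico M N} (log²m/m^{k+1}) cos(mφ)| ≤ (log²M/M^{k+1})/|sin(φ/2)|`
(`1 ≤ k`, `3 ≤ M`). -/
theorem abs_sum_Ico_logSq_div_pow_mul_cos_le {φ : ℝ} (hφ : Real.sin (φ / 2) ≠ 0) {k : ℕ} (hk : 1 ≤ k) {M : ℕ}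
    (hM : 3 ≤ M) (N : ℕ) :
    |∑ m ∈ Finset.Ico M N, Real.log m ^ 2 / (m : ℝ) ^ (k + 1) * Real.cos (m * φ)|
      ≤ (Real.log M ^ 2 / (M : ℝ) ^ (k + 1)) / |Real.sin (φ / 2)| := by
  obtain ⟨h0, hmono⟩ := logSq_div_pow_weight hk hM
  exact abs_sum_Ico_mul_cos_le hφ (g := fun m : ℕ ↦ Real.log m ^ 2 / (m : ℝ) ^ (k + 1)) h0 hmono N

/-- **Abel radius, log² weight, sine**: `|Σ_{m∈Ico M N} (log²m/m^{k+1}) sin(mφ)| ≤ (log²M/M^{k+1})/|sin(φ/2)|`. -/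
theorem abs_sum_Ico_logSq_div_pow_mul_sin_le {φ : ℝ} (hφ : Real.sin (φ / 2) ≠ 0) {k : ℕ} (hk : 1 ≤ k) {M : ℕ}
    (hM : 3 ≤ M) (N : ℕ) :
    |∑ m ∈ Finset.Ico M N, Real.log m ^ 2 / (m : ℝ) ^ (k + 1) * Real.sin (m * φ)|
      ≤ (Real.log M ^ 2 / (M : ℝ) ^ (k + 1)) / |Real.sin (φ / 2)| := by
  obtain ⟨h0, hmono⟩ := logSq_div_pow_weight hk hM
  exact abs_sum_Ico_mul_sin_le hφ (g := fun m : ℕ ↦ Real.log m ^ 2 / (m : ℝ) ^ (k + 1)) h0 hmono N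

end Summit.RiemannHypothesis.RiemannHypothesis.Theorems.WeilFormatC

end
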